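import Literature.MathematicalPhysics.QuantumFieldTheory.Balaban1983to89.B5Hk163Alias
import Literature.MathematicalPhysics.QuantumFieldTheory.Balaban1983to89.B4StripSumsDeriv

/-!
# `Balaban1983to89.B5Hk163Holder` — the PRINTED WEIGHTED ALIAS SUM of the (1.63) multipliers: `Σ_l |h_{l;μλ}(p′)|·|∂_ν(p′+l)|·|p′+l|^α ≤ C(d, α)`, uniformly in `k` (cell GAPS G-b05g10-2; successor of `B5Hk163Strip`, `B5Hk163Alias`)

T. Bałaban, *Propagators and renormalization transformations for lattice gauge theories. I*, Commun. Math.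
Phys. **95**, 17–40 (1984) [`Balaban1984PropagatorsI`, cell paper B5], p. 28 bottom – p. 29 top [PDF 12–13]
(renders `…rt-I-p012-x2.png`, `…-p013-x2.png` read as images), about the bracket of the momentum representation
(1.63) of `H_k` (typed `B5Symbol163.second163`; `= Σ_λ h163 μ λ l (p′) B̃_λ` by `B5Hk163Strip.second163_eq_sum_h163`),
verbatim: «This expression is well defined and bounded for all values of l and p′, including p′ = 0 where it is
defined as a limit for p′ → 0. Another important property is that the sum over l of the absolute value of this
expression multiplied by |∂_ν(p′+l)||p′+l|^α is bounded by a constant dependent on d only. This implies bounds on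
(1/|x′−x|^α)|∂_ν(H_kB)_μ(x′) − ∂_ν(H_kB)_μ(x)| (see the proof of Lemma 2.4 in [2].)»  No proof is printed.  This
module certifies the second sentence (the WEIGHTED alias sum) for the continued multiplier `h163` on the whole
zero-free strip (real momenta included), with OUR crude constant; `[folklore]` throughout, the `[cite: …]` tags are
TEXT LOCATIONS only — nothing printed enters as a hypothesis (ABSOLUTE RULE).

## Typed reading of the printed weight

* `∂_ν(p′+l)` is the fine-lattice forward-difference symbol `η⁻¹(e^{iη(p′_ν+l_ν)} − 1)`, continued to complex `p′`
  as `B5Hk163Strip.dC n l p′ ν` (`= B5Prop11Fiber.dSym` at real momenta, `B5Hk163Strip.dC_ofReal`);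
* `|p′+l|` (the length of the fine momentum `p = p′+l` in the fine Brillouin zone) is typed as the LATTICE LENGTH
  `(Σ_ν |∂_ν(p′+l)|²)^{1/2} = Δ^η(p′+l)^{1/2}`; on the fine zone `(2/π)|p|_c ≤ Δ^η(p)^{1/2} ≤ |p|_c` for the
  centred representative `p_c`, so the printed weight and ours differ by a factor in `[(2/π)^α, 1]` (this
  elementary comparison is NOT re-proved here);
* the weight is therefore `wt163 n l p′ ν α = ‖dC n l p′ ν‖ · (Σ_ν′ ‖dC n l p′ ν′‖²)^{α/2}` (§3), and the sum
  over `l` runs over all `n^d` alias classes `l ∈ 2π{0,…,n−1}^d` (`n = L^k`), as in `B5Hk163Alias`.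

## Content (sorry-free)

* §1 `norm_dC_le_omega`: `‖∂_ν(p′+l)‖ ≤ 17·ω_n(l_ν)` on `Strip d κ`, `κ ≤ 1`, every `n`, every `l`
  (`|e^{iθ/n} − 1|² = e^{−Im θ/n}(2cosh(Im θ/n) − 2cos(Re θ/n))` by `B4StripSums.norm_sq_exp_sub_one`/`norm_S1_eq`,
  the cosine re-centred modulo `2πn`, `Real.one_sub_sq_div_two_le_cos`, `Real.cosh_le_exp_half_sq`);
* §2 SHARP `W`-FORM per-alias bounds for `l ≠ 0`, keeping the quadratic gain `1/W_n(l)` of `Δ(p′)/Δ(p′+l)` WHOLE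
  (the landed `B5Hk163Alias` bounds spread it as `Π_ν ω^{−2/d}`, which does not survive the weight):
  `norm_sum_Afac_le_W_omega` (`‖Σ_{l′≠l} A_{l,l′}‖ ≤ c_A/(ω_n(l_μ)²·W_n(l))`, from the landed `norm_sum_Afac_le_W`),
  `norm_headC_le_W`, `norm_tailC_le_W`, `norm_h163_le_W`: `‖h_{l;μλ}(p′)‖ ≤ c_HW(d)·Π_ν(12/ω_n(l_ν))/W_n(l)`;
* §3 the weight: `wt163`, `wt163_le_of_ne` (`≤ c_wt(d)·W^{(1+α)/2}`, `l ≠ 0`), `wt163_zero_le`;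
* §4 `weighted_term_le`: `‖h_l‖·wt_l ≤ c_HW·c_wt·Π_ν 12·ω_n(l_ν)^{−(1+(1−α)/d)}` (`W^{−(1−α)/2} ≤ Π_ν ω^{−(1−α)/d}`,
  `W_rpow_le_prod163`), and `sum_prod_rpow_le163` (`Σ_l Π_ν 12ω_n(l_ν)^{−e} ≤ (24ζ(e))^d`, from the landed
  general-exponent residue sum `B4StripSumsDeriv.sum_omega_rpow_le_zetaS`: `Σ_{j∈ℤ_n} ω_n(j)^{−e} ≤ 2ζ(e)`, `e > 1`);
* §5 **`weighted_alias_sum_le`**: for `d ≥ 1`, `n ≥ 1`, `0 ≤ κ ≤ κ₁₆₃(d)`, `p′ ∈ Strip d κ`, `μ, λ, ν`, `0 ≤ α < 1`: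
  `Σ_l ‖h163 n μ λ l p′‖ · wt163 n l p′ ν α ≤ CHolder163 d α`, and the real-momentum instance
  `weighted_alias_sum_le_real` (`p′ ∈ [−π,π]^d`, the printed setting) — constants depending on `d` and `α` ONLY.

## Honest scope

(i) The constant is ours and crude; it depends on `d` and on `α` and diverges as `α → 1` (through `ζ(1+(1−α)/d)`);
the print says «dependent on d only» with `α` a fixed exponent.  (ii) `|p′+l|` is the lattice length (above).
(iii) The printed CONSEQUENCE (Hölder bounds on `∂_ν(H_kB)_μ`) needs the typed operator `H_k` (GAPS G-b05g10-4) and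
is not claimed.  (iv) `U = 1`, `m² = 0` as in the whole b05 lineage.  Value = kernel certificate of a printed,
unproved claim of B5, NOT summit progress, NOT continuum, NOT Clay.
-/

open scoped BigOperators Real
open Finset Complex

namespace Literature.MathematicalPhysics.QuantumFieldTheory.Balaban1983to89.B5Hk163Holder

open Literature.MathematicalPhysics.QuantumFieldTheory.Balaban1983to89.B4Strip
open Literature.MathematicalPhysics.QuantumFieldTheory.Balaban1983to89.B4StripCauchy
open Literature.MathematicalPhysics.QuantumFieldTheory.Balaban1983to89.B4ContourShift (BZ ofRealVec_mem_Strip)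
open Literature.MathematicalPhysics.QuantumFieldTheory.Balaban1983to89.B5Symbol166
open Literature.MathematicalPhysics.QuantumFieldTheory.Balaban1983to89.B5Strip145
open Literature.MathematicalPhysics.QuantumFieldTheory.Balaban1983to89.B5Symbol166Strip hiding Afac
open Literature.MathematicalPhysics.QuantumFieldTheory.Balaban1983to89.B5Hk163Strip
open Literature.MathematicalPhysics.QuantumFieldTheory.Balaban1983to89.B5Strip145Analytic
open Literature.MathematicalPhysics.QuantumFieldTheory.Balaban1983to89.B5Hk163Alias
open Literature.MathematicalPhysics.QuantumFieldTheory.Balaban1983to89.B4StripSums (omega omega_pos one_le_omega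
  omega_zero W W_nonneg one_le_W omega_sq_le_W norm_S1_eq norm_sq_exp_sub_one inv_W_le_prod_rpow)
open Literature.MathematicalPhysics.QuantumFieldTheory.Balaban1983to89.B4StripSumsDeriv (zetaS zetaS_nonneg
  sum_omega_rpow_le_zetaS)

noncomputable section

variable {d : ℕ}

/-! ## §1. The shifted forward-difference symbol is `O(ω)` on the strip -/

section Diff

variable (n : ℕ) [NeZero n]

/-- **`‖∂_ν(p′+l)‖ ≤ 17·ω_n(l_ν)`** on `Strip d κ`, `κ ≤ 1`, for every `n ≥ 1` and every alias `l = 2πk`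
(although `‖∂_ν(p′+l)‖` can be as large as `2n`, it is so only for residues `k_ν` far from `0` in `ℤ/n`). [folklore] -/
theorem norm_dC_le_omega {κ : ℝ} (hκ1 : κ ≤ 1) {p : Fin d → ℂ} (hp : p ∈ Strip d κ) (k : Fin d → Fin n)
    (ν : Fin d) : ‖dC n k p ν‖ ≤ 17 * omega n (k ν) := by
  have hn1 : 1 ≤ n := Nat.one_le_iff_ne_zero.mpr (NeZero.ne n)
  have hn : (0 : ℝ) < n := Nat.cast_pos.mpr (Nat.pos_of_ne_zero (NeZero.ne n))
  have hn1r : (1 : ℝ) ≤ n := by exact_mod_cast hn1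
  have hjn : ((k ν : ℕ) : ℝ) + 1 ≤ n := by exact_mod_cast (k ν).isLt
  have hj0 : (0 : ℝ) ≤ ((k ν : ℕ) : ℝ) := Nat.cast_nonneg _
  have hω1 := one_le_omega n (k ν) (k ν).isLt
  have hπ := Real.pi_pos
  have hπ3 : π < 3.15 := Real.pi_lt_d2
  have hxre : |(p ν).re| ≤ π := (hp ν).1
  have hyim : |(p ν).im| ≤ 1 := (hp ν).2.trans hκ1
  set x : ℝ := (p ν).re + 2 * π * ((k ν : ℕ) : ℝ) with hxdef
  set y : ℝ := (p ν).im with hydef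
  set θ : ℂ := shift n k p ν / n with hθdef
  have hθre : θ.re = x / n := by
    have hs : shift n k p ν = p ν + ((2 * π * ((k ν : ℕ) : ℝ) : ℝ) : ℂ) := by
      simp only [shift]; push_cast; ring
    rw [hθdef, Complex.div_natCast_re, hs, Complex.add_re, Complex.ofReal_re]
  have hθim : θ.im = y / n := by
    rw [hθdef, Complex.div_natCast_im, shift_im]
  -- the squared modulus of `e^{iθ} − 1`
  have key : ‖cexp (θ * I) - 1‖ ^ 2 = Real.exp (-θ.im) * (2 * Real.cosh θ.im - 2 * Real.cos θ.re) := by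
    have h := norm_sq_exp_sub_one (-θ)
    rw [norm_S1_eq] at h
    have e1 : -(I * -θ) = θ * I := by ring
    rw [e1, Complex.neg_im, Complex.neg_re, Real.cosh_neg, Real.cos_neg] at h
    exact h
  -- the hyperbolic part
  have hyn : |y / n| ≤ 1 := by
    rw [abs_div, abs_of_pos hn, div_le_one hn]
    exact hyim.trans hn1r
  have hyn2 : (y / n) ^ 2 ≤ 1 := by
    have h := pow_le_one₀ (abs_nonneg (y / n)) hyn (n := 2)
    rwa [sq_abs] at h
  have hcosh : 2 * Real.cosh (y / n) - 2 ≤ 2 * (y / n) ^ 2 := by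
    have hc := Real.cosh_le_exp_half_sq (y / n)
    have ht : |(y / n) ^ 2 / 2| ≤ 1 := by
      rw [abs_of_nonneg (by positivity)]; linarith
    have he := Real.abs_exp_sub_one_le ht
    have he' : Real.exp ((y / n) ^ 2 / 2) - 1 ≤ 2 * ((y / n) ^ 2 / 2) := by
      have h1 := (le_abs_self _).trans he
      rwa [abs_of_nonneg (by positivity : (0 : ℝ) ≤ (y / n) ^ 2 / 2)] at h1
    linarith
  -- the trigonometric part, re-centred modulo `2πn`
  have hcos : ∃ x' : ℝ, Real.cos (x' / n) = Real.cos θ.re ∧ |x'| ≤ 3 * π * omega n (k ν) := by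
    by_cases hcase : ((k ν : ℕ) : ℝ) + 1 ≤ (n : ℝ) - (k ν : ℕ)
    · refine ⟨x, by rw [hθre], ?_⟩
      have hωeq : omega n (k ν) = ((k ν : ℕ) : ℝ) + 1 := min_eq_left hcase
      rw [hωeq]
      calc |x| ≤ |(p ν).re| + |2 * π * ((k ν : ℕ) : ℝ)| := abs_add_le _ _
        _ ≤ π + 2 * π * ((k ν : ℕ) : ℝ) := by
            rw [abs_of_nonneg (by positivity : (0 : ℝ) ≤ 2 * π * ((k ν : ℕ) : ℝ))]; linarith
        _ ≤ 3 * π * (((k ν : ℕ) : ℝ) + 1) := by nlinarith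
    · refine ⟨x - 2 * π * n, ?_, ?_⟩
      · rw [hθre, show (x - 2 * π * n) / n = x / n - 2 * π by field_simp, Real.cos_sub_two_pi]
      · have hωeq : omega n (k ν) = (n : ℝ) - (k ν : ℕ) := min_eq_right (le_of_lt (not_le.mp hcase))
        rw [hωeq]
        have h1 : 1 ≤ (n : ℝ) - (k ν : ℕ) := by linarith
        have : x - 2 * π * n = (p ν).re - 2 * π * ((n : ℝ) - (k ν : ℕ)) := by rw [hxdef]; ring
        rw [this]
        calc |(p ν).re - 2 * π * ((n : ℝ) - (k ν : ℕ))|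
            ≤ |(p ν).re| + |2 * π * ((n : ℝ) - (k ν : ℕ))| := abs_sub _ _
          _ ≤ π + 2 * π * ((n : ℝ) - (k ν : ℕ)) := by
              rw [abs_of_nonneg (mul_nonneg (by positivity) (by linarith) :
                (0 : ℝ) ≤ 2 * π * ((n : ℝ) - (k ν : ℕ)))]
              linarith
          _ ≤ 3 * π * ((n : ℝ) - (k ν : ℕ)) := by nlinarith
  obtain ⟨x', hx'cos, hx'abs⟩ := hcos
  have hcosb : 2 - 2 * Real.cos θ.re ≤ (x' / n) ^ 2 := by
    rw [← hx'cos]; have := Real.one_sub_sq_div_two_le_cos (x := x' / n); linarith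
  have hexp : Real.exp (-θ.im) ≤ 3 := by
    have h1 : -θ.im ≤ 1 := by
      rw [hθim]; exact (neg_le_abs _).trans hyn
    calc Real.exp (-θ.im) ≤ Real.exp 1 := Real.exp_le_exp.mpr h1
      _ ≤ 3 := by have := Real.exp_one_lt_d9; norm_num at this; linarith
  have hA : 2 * Real.cosh θ.im - 2 * Real.cos θ.re ≤ 2 * (y / n) ^ 2 + (x' / n) ^ 2 := by
    rw [hθim]; linarith
  have hB : 0 ≤ 2 * Real.cosh θ.im - 2 * Real.cos θ.re := by
    have := Real.one_le_cosh θ.im; have := Real.cos_le_one θ.re; linarith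
  have hy2 : y ^ 2 ≤ 1 := by
    have h := pow_le_one₀ (abs_nonneg y) hyim (n := 2)
    rwa [sq_abs] at h
  have hx2 : x' ^ 2 ≤ (3 * π * omega n (k ν)) ^ 2 := by
    have h := pow_le_pow_left₀ (abs_nonneg x') hx'abs 2
    rwa [sq_abs] at h
  have hsq : ‖dC n k p ν‖ ^ 2 ≤ (17 * omega n (k ν)) ^ 2 := by
    have hdC : dC n k p ν = n * (cexp (θ * I) - 1) := rfl
    rw [hdC, norm_mul, Complex.norm_natCast, mul_pow, key]
    calc (n : ℝ) ^ 2 * (Real.exp (-θ.im) * (2 * Real.cosh θ.im - 2 * Real.cos θ.re))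
        ≤ (n : ℝ) ^ 2 * (3 * (2 * (y / n) ^ 2 + (x' / n) ^ 2)) :=
          mul_le_mul_of_nonneg_left (mul_le_mul hexp hA hB (by norm_num)) (sq_nonneg _)
      _ = 3 * (2 * y ^ 2 + x' ^ 2) := by field_simp
      _ ≤ 3 * (2 * 1 + (3 * π * omega n (k ν)) ^ 2) := by nlinarith
      _ ≤ (17 * omega n (k ν)) ^ 2 := by
          have hπ2 : π ^ 2 ≤ 9.93 := by nlinarith
          have hω2 : 0 ≤ omega n (k ν) ^ 2 := sq_nonneg _
          have hωge : 1 ≤ omega n (k ν) ^ 2 := by nlinarith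
          have hprod : π ^ 2 * omega n (k ν) ^ 2 ≤ 9.93 * omega n (k ν) ^ 2 :=
            mul_le_mul_of_nonneg_right hπ2 hω2
          have e1 : 3 * (2 * 1 + (3 * π * omega n (k ν)) ^ 2) = 6 + 27 * (π ^ 2 * omega n (k ν) ^ 2) := by
            ring
          have e2 : (17 * omega n (k ν)) ^ 2 = 289 * omega n (k ν) ^ 2 := by ring
          rw [e1, e2]
          linarith
  exact (pow_le_pow_iff_left₀ (norm_nonneg _) (by positivity) two_ne_zero).mp hsq

end Diff

/-! ## §2. Sharp `W`-form per-alias bounds (`l ≠ 0`) -/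

section WForm

variable (n : ℕ) [NeZero n]

/-- the alias `l′`-sum with the full quadratic gain: `‖Σ_{l′≠l} A_{l,l′}‖ ≤ c_A(d)/(ω_n(l_μ)²·W_n(l))`, `l ≠ 0`
(the landed `norm_sum_Afac_le_W`, with `‖|v_μ(p′+l)|²‖ ≤ 64/ω_n(l_μ)²` and `1/W² ≤ ω_n(l_μ)⁻²/W`). [folklore] -/
theorem norm_sum_Afac_le_W_omega {r : ℝ} (hr : r ≤ 1 / 4) (hdr : (d : ℝ) * r ^ 2 ≤ 1 / 16) {q : Fin d → ℂ}
    (hq : q ∈ Fat d r) (μ : Fin d) (k : Fin d → Fin n) (hk : k ≠ fun _ => 0) :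
    ‖∑ k' ∈ univ.erase k, Afac n μ k k' q‖ ≤ cA163 d * ((omega n (k μ) ^ 2)⁻¹ * (1 / W n k)) := by
  set P : ℝ := (omega n (k μ) ^ 2)⁻¹ * (1 / W n k) with hPdef
  have hW1 := one_le_W n k hk
  have hW0 : 0 < W n k := by linarith
  have hω := omega_pos n (k μ) (k μ).isLt
  have hωW : omega n (k μ) ^ 2 ≤ W n k := omega_sq_le_W n k hk μ
  have hTa := cTa163_nonneg d
  have hTb := cTb163_nonneg d
  have hP0 : 0 ≤ P := by positivity
  have hinv : 1 / W n k ≤ (omega n (k μ) ^ 2)⁻¹ := by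
    rw [one_div]; exact inv_anti₀ (by positivity) hωW
  have h1 : cTa163 d / W n k ^ 2 ≤ cTa163 d * P := by
    have : 1 / W n k ^ 2 ≤ P := by
      rw [hPdef, show 1 / W n k ^ 2 = (1 / W n k) * (1 / W n k) by rw [sq, one_div_mul_one_div]]
      exact mul_le_mul_of_nonneg_right hinv (by positivity)
    calc cTa163 d / W n k ^ 2 = cTa163 d * (1 / W n k ^ 2) := by rw [← div_eq_mul_one_div]
      _ ≤ cTa163 d * P := mul_le_mul_of_nonneg_left this hTa
  have h2 : ‖uFactor n (k μ : ℕ) (q μ)‖ * (cTb163 d / W n k) ≤ 64 * cTb163 d * P := by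
    have hu := norm_uFactor_le_omega n hr hq k μ
    calc ‖uFactor n (k μ : ℕ) (q μ)‖ * (cTb163 d / W n k)
        ≤ 64 / omega n (k μ) ^ 2 * (cTb163 d / W n k) :=
          mul_le_mul_of_nonneg_right hu (by positivity)
      _ = 64 * cTb163 d * P := by rw [hPdef]; ring
  calc ‖∑ k' ∈ univ.erase k, Afac n μ k k' q‖
      ≤ 132 ^ d * (132 * (cTa163 d / W n k ^ 2) + ‖uFactor n (k μ : ℕ) (q μ)‖ * (cTb163 d / W n k)) :=
        norm_sum_Afac_le_W n hr hdr hq μ k hk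
    _ ≤ 132 ^ d * (132 * (cTa163 d * P) + 64 * cTb163 d * P) := by gcongr
    _ = cA163 d * P := by unfold cA163; ring

/-- the constant `c_headW(d) = 2·(16d·64/7)/c_Y(d)` of the `W`-form head bound. [folklore] -/
def cHeadW (d : ℕ) : ℝ := 2 * (16 * d * (64 / 7)) / cY163 d

/-- `c_headW(d) ≥ 0`. [folklore] -/
theorem cHeadW_nonneg (d : ℕ) : 0 ≤ cHeadW d := by
  unfold cHeadW; have := cY163_pos d; positivity

/-- **`W`-FORM HEAD BOUND**: `‖headC_l‖ ≤ c_headW(d)·Π_ν(12/ω_n(l_ν))/W_n(l)` on the zero-free strip, `l ≠ 0`. [folklore] -/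
theorem norm_headC_le_W {κ : ℝ} (hκ0 : 0 ≤ κ) (hκ : κ ≤ kappa163 d) {p : Fin d → ℂ}
    (hp : p ∈ Strip d κ) (μ : Fin d) (k : Fin d → Fin n) (hk : k ≠ fun _ => 0) :
    ‖headC n μ k p‖ ≤ cHeadW d * ((∏ ν, 12 / omega n (k ν)) * (1 / W n k)) := by
  have hr := rOf_le d
  have hdr := d_mul_rOf_sq_le d
  have hq : p ∈ Fat d (rOf d) := strip_subset_fat (rOf_pos d).le (hκ.trans (kappa163_le_rOf d)) hp
  have hY := Yc_lower n hκ0 (hκ.trans (kappa163_le_kappaY d)) μ p hp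
  have hW1 := one_le_W n k hk
  have hA0 : 0 ≤ ∏ ν, 12 / omega n (k ν) :=
    Finset.prod_nonneg (fun ν _ => div_nonneg (by norm_num) (omega_pos n (k ν) (k ν).isLt).le)
  have h1 := norm_uCbar_le_prod n hr hq k
  have h2 := norm_vCbar_le n hr hq k μ
  have h3 := norm_rho_le_W n hr hdr hq k hk
  unfold headC
  calc ‖uCbar n k p * vCbar n k p μ * rho n k p / Yc n μ p‖
      ≤ (∏ ν, 12 / omega n (k ν)) * 2 * (16 * d * (64 / 7) / W n k) / cY163 d := by
        refine norm_div_le_of ?_ (cY163_pos d) hY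
        rw [norm_mul, norm_mul]
        exact mul_le_mul (mul_le_mul h1 h2 (norm_nonneg _) hA0) h3 (norm_nonneg _) (by positivity)
    _ = cHeadW d * ((∏ ν, 12 / omega n (k ν)) * (1 / W n k)) := by
        unfold cHeadW; ring

/-- **`W`-FORM TAIL BOUND**: `‖tailC_l‖ ≤ c_tail(d)·ω_n(l_μ)⁻²·W_n(l)⁻¹·Π_{ν≠μ}(12/ω_n(l_ν))` on the zero-free
strip, `l ≠ 0`. [folklore] -/
theorem norm_tailC_le_W {κ : ℝ} (hκ0 : 0 ≤ κ) (hκ : κ ≤ kappa163 d) {p : Fin d → ℂ}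
    (hp : p ∈ Strip d κ) (μ : Fin d) (k : Fin d → Fin n) (hk : k ≠ fun _ => 0) :
    ‖tailC n μ k p‖ ≤ cTail163 d * ((omega n (k μ) ^ 2)⁻¹ * (1 / W n k) *
      ∏ ν ∈ univ.erase μ, 12 / omega n (k ν)) := by
  have hr := rOf_le d
  have hdr := d_mul_rOf_sq_le d
  have hq : p ∈ Fat d (rOf d) := strip_subset_fat (rOf_pos d).le (hκ.trans (kappa163_le_rOf d)) hp
  obtain ⟨hF, hN, hY, _⟩ := denominators_lower n hκ0 hκ hp
  have hB := one_le_Bc d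
  have hcA := cA163_nonneg d
  have hω := omega_pos n (k μ) (k μ).isLt
  have hW1 := one_le_W n k hk
  have hA0 : 0 ≤ ∏ ν ∈ univ.erase μ, 12 / omega n (k ν) :=
    Finset.prod_nonneg (fun ν _ => div_nonneg (by norm_num) (omega_pos n (k ν) (k ν).isLt).le)
  have h1 := norm_dC_mul_uCbar_le_prod n hr hq k μ
  have h2 := norm_sum_Afac_le_W_omega n hr hdr hq μ k hk
  unfold tailC
  rw [norm_mul]
  calc ‖dC n k p μ * uCbar n k p * (∑ k' ∈ univ.erase k, Afac n μ k k' p) / Ncal n p‖ *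
        ‖(∏ ν, Yc n ν p) / (Yc n μ p * F66 n p)‖
      ≤ (4 * ∏ ν ∈ univ.erase μ, 12 / omega n (k ν)) *
          (cA163 d * ((omega n (k μ) ^ 2)⁻¹ * (1 / W n k))) /
          cN163 d * ((2 * Bc d ^ 2) ^ d / (cY163 d * cF163 d)) := by
        refine mul_le_mul ?_ ?_ (norm_nonneg _) (by have := cN163_pos d; positivity)
        · refine norm_div_le_of ?_ (cN163_pos d) hN
          rw [norm_mul]
          exact mul_le_mul h1 h2 (norm_nonneg _) (by positivity)
        · refine norm_div_le_of ?_ (mul_pos (cY163_pos d) (cF163_pos d)) ?_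
          · exact norm_prod_le_pow _ _ (by nlinarith) (by simp) (fun ν _ => norm_Yc_le n hr hdr hq ν)
          · rw [norm_mul]
            exact mul_le_mul (hY μ) hF (cF163_pos d).le (norm_nonneg _)
    _ = cTail163 d * ((omega n (k μ) ^ 2)⁻¹ * (1 / W n k) *
          ∏ ν ∈ univ.erase μ, 12 / omega n (k ν)) := by
        unfold cTail163; ring

/-- the constant `c_HW(d) = c_headW + c_tail·M_g` of the `W`-form bound on `h163`. [folklore] -/
def cHW (d : ℕ) : ℝ := cHeadW d + cTail163 d * Mg163 d

/-- `c_HW(d) ≥ 0`. [folklore] -/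
theorem cHW_nonneg (d : ℕ) : 0 ≤ cHW d := by
  unfold cHW
  have := cHeadW_nonneg d; have := cTail163_nonneg d; have := Mg163_nonneg d
  positivity

/-- **`W`-FORM BOUND ON THE (1.63) MULTIPLIER**: `‖h_{l;μλ}(p′)‖ ≤ c_HW(d)·Π_ν(12/ω_n(l_ν))/W_n(l)` on the zero-free
strip, `l ≠ 0`, every `n` — the quadratic gain kept whole. [folklore] -/
theorem norm_h163_le_W {κ : ℝ} (hκ0 : 0 ≤ κ) (hκ : κ ≤ kappa163 d) {p : Fin d → ℂ}
    (hp : p ∈ Strip d κ) (μ lam : Fin d) (k : Fin d → Fin n) (hk : k ≠ fun _ => 0) :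
    ‖h163 n μ lam k p‖ ≤ cHW d * ((∏ ν, 12 / omega n (k ν)) * (1 / W n k)) := by
  set Q : ℝ := (∏ ν, 12 / omega n (k ν)) * (1 / W n k) with hQdef
  have hW1 := one_le_W n k hk
  have hω := omega_pos n (k μ) (k μ).isLt
  have hω1 := one_le_omega n (k μ) (k μ).isLt
  have hA0 : 0 ≤ ∏ ν ∈ univ.erase μ, 12 / omega n (k ν) :=
    Finset.prod_nonneg (fun ν _ => div_nonneg (by norm_num) (omega_pos n (k ν) (k ν).isLt).le)
  have hQ0 : 0 ≤ Q := mul_nonneg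
    (Finset.prod_nonneg (fun ν _ => div_nonneg (by norm_num) (omega_pos n (k ν) (k ν).isLt).le))
    (by positivity)
  have hH := norm_headC_le_W n hκ0 hκ hp μ k hk
  have hT := norm_tailC_le_W n hκ0 hκ hp μ k hk
  have hg := norm_gdir_le n hκ0 hκ hp lam
  have hMg : 0 ≤ Mg163 d := Mg163_nonneg d
  have hcT := cTail163_nonneg d
  -- absorb `ω_n(l_μ)⁻²` into the product: `ω⁻² ≤ 12/ω` since `ω ≥ 1`
  have hmix : (omega n (k μ) ^ 2)⁻¹ * (1 / W n k) * ∏ ν ∈ univ.erase μ, 12 / omega n (k ν) ≤ Q := by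
    have hprod : (∏ ν, 12 / omega n (k ν)) = 12 / omega n (k μ) * ∏ ν ∈ univ.erase μ, 12 / omega n (k ν) :=
      (Finset.mul_prod_erase _ _ (Finset.mem_univ μ)).symm
    have hle : (omega n (k μ) ^ 2)⁻¹ ≤ 12 / omega n (k μ) := by
      rw [le_div_iff₀ hω]
      have : (omega n (k μ) ^ 2)⁻¹ * omega n (k μ) = (omega n (k μ))⁻¹ := by
        field_simp
      rw [this]
      exact (inv_le_one_of_one_le₀ hω1).trans (by norm_num)
    rw [hQdef, hprod]
    calc (omega n (k μ) ^ 2)⁻¹ * (1 / W n k) * ∏ ν ∈ univ.erase μ, 12 / omega n (k ν)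
        = (omega n (k μ) ^ 2)⁻¹ * ((∏ ν ∈ univ.erase μ, 12 / omega n (k ν)) * (1 / W n k)) := by ring
      _ ≤ 12 / omega n (k μ) * ((∏ ν ∈ univ.erase μ, 12 / omega n (k ν)) * (1 / W n k)) :=
          mul_le_mul_of_nonneg_right hle (by positivity)
      _ = 12 / omega n (k μ) * (∏ ν ∈ univ.erase μ, 12 / omega n (k ν)) * (1 / W n k) := by ring
  have hterm : ‖h163 n μ lam k p‖ ≤ ‖headC n μ k p‖ + ‖tailC n μ k p‖ * Mg163 d := by
    unfold h163
    refine (norm_add_le _ _).trans (add_le_add ?_ ?_)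
    · by_cases hlm : lam = μ
      · simp only [hlm, if_true]; exact le_rfl
      · simp only [hlm, if_false, norm_zero]; exact norm_nonneg _
    · rw [norm_mul]
      exact mul_le_mul_of_nonneg_left hg (norm_nonneg _)
  calc ‖h163 n μ lam k p‖ ≤ ‖headC n μ k p‖ + ‖tailC n μ k p‖ * Mg163 d := hterm
    _ ≤ cHeadW d * Q + cTail163 d * Q * Mg163 d := by
        refine add_le_add hH (mul_le_mul_of_nonneg_right ?_ hMg)
        exact hT.trans (mul_le_mul_of_nonneg_left hmix hcT)
    _ = cHW d * Q := by unfold cHW; ring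

end WForm

/-! ## §3. The printed weight `|∂_ν(p′+l)|·|p′+l|^α` -/

section Weight

variable (n : ℕ) [NeZero n]

/-- THE WEIGHT `|∂_ν(p′+l)|·|p′+l|^α`, with `|p′+l|` the lattice length `(Σ_ν′ |∂_ν′(p′+l)|²)^{1/2}`, continued to
the strip through `dC`. [cite: Balaban1984PropagatorsI, p.29 (text only)] [folklore] -/
def wt163 (k : Fin d → Fin n) (p : Fin d → ℂ) (ν : Fin d) (α : ℝ) : ℝ :=
  ‖dC n k p ν‖ * (∑ ν', ‖dC n k p ν'‖ ^ 2) ^ (α / 2)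

omit [NeZero n] in
/-- the weight is non-negative. [folklore] -/
theorem wt163_nonneg (k : Fin d → Fin n) (p : Fin d → ℂ) (ν : Fin d) (α : ℝ) : 0 ≤ wt163 n k p ν α :=
  mul_nonneg (norm_nonneg _) (Real.rpow_nonneg (Finset.sum_nonneg (fun _ _ => sq_nonneg _)) _)

/-- `Σ_ν ω_n(l_ν)² ≤ (d+1)·W_n(l)` for `l ≠ 0` (the coordinates with `l_ν = 0` contribute `ω = 1 ≤ W`). [folklore] -/
theorem sum_omega_sq_le_W (k : Fin d → Fin n) (hk : k ≠ fun _ => 0) :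
    ∑ ν, omega n (k ν) ^ 2 ≤ ((d : ℝ) + 1) * W n k := by
  have hn : 1 ≤ n := Nat.one_le_iff_ne_zero.mpr (NeZero.ne n)
  have hterm : ∀ ν, omega n (k ν) ^ 2 ≤ (if (k ν : ℕ) = 0 then 0 else omega n (k ν) ^ 2) + 1 := by
    intro ν
    split_ifs with h
    · rw [h, omega_zero n hn]; norm_num
    · linarith
  have h1 : ∑ ν, omega n (k ν) ^ 2 ≤ W n k + d := by
    calc ∑ ν, omega n (k ν) ^ 2 ≤ ∑ ν, ((if (k ν : ℕ) = 0 then 0 else omega n (k ν) ^ 2) + 1) :=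
          Finset.sum_le_sum (fun ν _ => hterm ν)
      _ = W n k + d := by
          rw [Finset.sum_add_distrib, Finset.sum_const, Finset.card_univ, Fintype.card_fin]
          simp [W]
  have hW1 := one_le_W n k hk
  have hd0 : (0 : ℝ) ≤ d := Nat.cast_nonneg d
  nlinarith

/-- `Σ_ν ‖∂_ν(p′+l)‖² ≤ 289·Σ_ν ω_n(l_ν)²` on the strip. [folklore] -/
theorem sum_norm_dC_sq_le {κ : ℝ} (hκ1 : κ ≤ 1) {p : Fin d → ℂ} (hp : p ∈ Strip d κ) (k : Fin d → Fin n) :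
    ∑ ν, ‖dC n k p ν‖ ^ 2 ≤ 289 * ∑ ν, omega n (k ν) ^ 2 := by
  rw [Finset.mul_sum]
  refine Finset.sum_le_sum (fun ν _ => ?_)
  have h := norm_dC_le_omega n hκ1 hp k ν
  have h0 := norm_nonneg (dC n k p ν)
  nlinarith

/-- the weight constant `c_wt(d) = 289·√(d+1)`. [folklore] -/
def cWt (d : ℕ) : ℝ := 289 * Real.sqrt ((d : ℝ) + 1)

/-- `c_wt(d) ≥ 0`. [folklore] -/
theorem cWt_nonneg (d : ℕ) : 0 ≤ cWt d := by unfold cWt; positivity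

omit [NeZero n] in
/-- `x^{α/2} ≤ B^{α/2} ≤ √B` for `0 ≤ x ≤ B`, `1 ≤ B`, `0 ≤ α ≤ 1`. [folklore] -/
theorem rpow_half_le_sqrt163 {x B α : ℝ} (hx0 : 0 ≤ x) (hxB : x ≤ B) (hB : 1 ≤ B) (hα0 : 0 ≤ α)
    (hα1 : α ≤ 1) : x ^ (α / 2) ≤ Real.sqrt B := by
  calc x ^ (α / 2) ≤ B ^ (α / 2) := Real.rpow_le_rpow hx0 hxB (by linarith)
    _ ≤ B ^ ((1 : ℝ) / 2) := Real.rpow_le_rpow_of_exponent_le hB (by linarith)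
    _ = Real.sqrt B := by rw [Real.sqrt_eq_rpow]

/-- **THE WEIGHT IS `O(W^{(1+α)/2})`**: `wt163 n l p′ ν α ≤ c_wt(d)·W_n(l)^{(1+α)/2}` on the strip (`κ ≤ 1`), `l ≠ 0`,
`0 ≤ α ≤ 1`. [folklore] -/
theorem wt163_le_of_ne {κ : ℝ} (hκ1 : κ ≤ 1) {p : Fin d → ℂ} (hp : p ∈ Strip d κ) (k : Fin d → Fin n)
    (hk : k ≠ fun _ => 0) (ν : Fin d) {α : ℝ} (hα0 : 0 ≤ α) (hα1 : α ≤ 1) :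
    wt163 n k p ν α ≤ cWt d * W n k ^ ((1 + α) / 2) := by
  have hW1 := one_le_W n k hk
  have hW0 : 0 < W n k := by linarith
  have hd0 : (0 : ℝ) ≤ d := Nat.cast_nonneg d
  have h1 : ‖dC n k p ν‖ ≤ 17 * Real.sqrt (W n k) := by
    have h := norm_dC_le_omega n hκ1 hp k ν
    have hω : omega n (k ν) ≤ Real.sqrt (W n k) := by
      rw [← Real.sqrt_sq (omega_pos n (k ν) (k ν).isLt).le]
      exact Real.sqrt_le_sqrt (omega_sq_le_W n k hk ν)
    nlinarith
  have hS0 : 0 ≤ ∑ ν', ‖dC n k p ν'‖ ^ 2 := Finset.sum_nonneg (fun _ _ => sq_nonneg _)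
  have hS : ∑ ν', ‖dC n k p ν'‖ ^ 2 ≤ (289 * ((d : ℝ) + 1)) * W n k := by
    have := sum_norm_dC_sq_le n hκ1 hp k
    have := sum_omega_sq_le_W n k hk
    nlinarith
  have h2 : (∑ ν', ‖dC n k p ν'‖ ^ 2) ^ (α / 2) ≤ 17 * Real.sqrt ((d : ℝ) + 1) * W n k ^ (α / 2) := by
    have hB1 : (1 : ℝ) ≤ 289 * ((d : ℝ) + 1) := by nlinarith
    calc (∑ ν', ‖dC n k p ν'‖ ^ 2) ^ (α / 2) ≤ ((289 * ((d : ℝ) + 1)) * W n k) ^ (α / 2) :=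
          Real.rpow_le_rpow hS0 hS (by linarith)
      _ = (289 * ((d : ℝ) + 1)) ^ (α / 2) * W n k ^ (α / 2) := Real.mul_rpow (by positivity) hW0.le
      _ ≤ Real.sqrt (289 * ((d : ℝ) + 1)) * W n k ^ (α / 2) :=
          mul_le_mul_of_nonneg_right (rpow_half_le_sqrt163 (by positivity) le_rfl hB1 hα0 hα1)
            (Real.rpow_nonneg hW0.le _)
      _ = 17 * Real.sqrt ((d : ℝ) + 1) * W n k ^ (α / 2) := by
          rw [Real.sqrt_mul (by norm_num), show (289 : ℝ) = 17 ^ 2 by norm_num,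
            Real.sqrt_sq (by norm_num)]
  have hsqrtW : Real.sqrt (W n k) = W n k ^ ((1 : ℝ) / 2) := Real.sqrt_eq_rpow (W n k)
  unfold wt163
  calc ‖dC n k p ν‖ * (∑ ν', ‖dC n k p ν'‖ ^ 2) ^ (α / 2)
      ≤ (17 * Real.sqrt (W n k)) * (17 * Real.sqrt ((d : ℝ) + 1) * W n k ^ (α / 2)) :=
        mul_le_mul h1 h2 (Real.rpow_nonneg hS0 _) (by positivity)
    _ = cWt d * (W n k ^ ((1 : ℝ) / 2) * W n k ^ (α / 2)) := by rw [hsqrtW]; unfold cWt; ring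
    _ = cWt d * W n k ^ ((1 + α) / 2) := by
        rw [← Real.rpow_add hW0]; congr 1; congr 1; ring

/-- at the zero alias the weight is bounded by the same constant: `wt163 n 0 p′ ν α ≤ c_wt(d)`. [folklore] -/
theorem wt163_zero_le {κ : ℝ} (hκ1 : κ ≤ 1) {p : Fin d → ℂ} (hp : p ∈ Strip d κ) (ν : Fin d) {α : ℝ}
    (hα0 : 0 ≤ α) (hα1 : α ≤ 1) : wt163 n (fun _ => 0) p ν α ≤ cWt d := by
  have hn : 1 ≤ n := Nat.one_le_iff_ne_zero.mpr (NeZero.ne n)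
  have hd0 : (0 : ℝ) ≤ d := Nat.cast_nonneg d
  have h1 : ‖dC n (fun _ => 0) p ν‖ ≤ 17 := by
    have h := norm_dC_le_omega n hκ1 hp (fun _ => 0) ν
    simp only [Fin.val_zero, omega_zero n hn, mul_one] at h
    exact h
  have hS0 : 0 ≤ ∑ ν', ‖dC n (fun _ => 0) p ν'‖ ^ 2 := Finset.sum_nonneg (fun _ _ => sq_nonneg _)
  have hS : ∑ ν', ‖dC n (fun _ => 0) p ν'‖ ^ 2 ≤ 289 * ((d : ℝ) + 1) := by
    have h := sum_norm_dC_sq_le n hκ1 hp (fun _ => 0)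
    simp only [Fin.val_zero, omega_zero n hn, one_pow, Finset.sum_const, Finset.card_univ,
      Fintype.card_fin, nsmul_eq_mul, mul_one] at h
    nlinarith
  have hB1 : (1 : ℝ) ≤ 289 * ((d : ℝ) + 1) := by nlinarith
  have h2 : (∑ ν', ‖dC n (fun _ => 0) p ν'‖ ^ 2) ^ (α / 2) ≤ 17 * Real.sqrt ((d : ℝ) + 1) := by
    calc (∑ ν', ‖dC n (fun _ => 0) p ν'‖ ^ 2) ^ (α / 2) ≤ Real.sqrt (289 * ((d : ℝ) + 1)) :=
          rpow_half_le_sqrt163 hS0 hS hB1 hα0 hα1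
      _ = 17 * Real.sqrt ((d : ℝ) + 1) := by
          rw [Real.sqrt_mul (by norm_num), show (289 : ℝ) = 17 ^ 2 by norm_num, Real.sqrt_sq (by norm_num)]
  unfold wt163
  calc ‖dC n (fun _ => 0) p ν‖ * (∑ ν', ‖dC n (fun _ => 0) p ν'‖ ^ 2) ^ (α / 2)
      ≤ 17 * (17 * Real.sqrt ((d : ℝ) + 1)) := mul_le_mul h1 h2 (Real.rpow_nonneg hS0 _) (by norm_num)
    _ = cWt d := by unfold cWt; ring

end Weight

/-! ## §4. The weighted alias term and the `n`-uniform residue sums -/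

section Term

variable (n : ℕ) [NeZero n]

/-- `W_n(l)^{(α−1)/2} ≤ Π_ν ω_n(l_ν)^{−(1−α)/d}` for `l ≠ 0`, `α ≤ 1` (the gain spread evenly over the coordinates,
from `B4StripSums.inv_W_le_prod_rpow`). [folklore] -/
theorem W_rpow_le_prod163 (hd : 0 < d) (k : Fin d → Fin n) (hk : k ≠ fun _ => 0) {α : ℝ} (hα1 : α ≤ 1) :
    W n k ^ ((α - 1) / 2) ≤ ∏ ν, omega n (k ν) ^ (-((1 - α) / d)) := by
  have hW1 := one_le_W n k hk
  have hW0 : 0 < W n k := by linarith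
  have h := inv_W_le_prod_rpow n hd k hk
  have he : 0 ≤ (1 - α) / 2 := by linarith
  calc W n k ^ ((α - 1) / 2) = (1 / W n k) ^ ((1 - α) / 2) := by
        rw [show (α - 1) / 2 = -((1 - α) / 2) by ring, Real.rpow_neg hW0.le, ← Real.inv_rpow hW0.le,
          inv_eq_one_div]
    _ ≤ (∏ ν, omega n (k ν) ^ (-(2 : ℝ) / d)) ^ ((1 - α) / 2) :=
        Real.rpow_le_rpow (by positivity) h he
    _ = ∏ ν, (omega n (k ν) ^ (-(2 : ℝ) / d)) ^ ((1 - α) / 2) :=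
        (Real.finsetProd_rpow _ _ (fun ν _ => Real.rpow_nonneg (omega_pos n (k ν) (k ν).isLt).le _) _).symm
    _ = ∏ ν, omega n (k ν) ^ (-((1 - α) / d)) := by
        refine Finset.prod_congr rfl (fun ν _ => ?_)
        rw [← Real.rpow_mul (omega_pos n (k ν) (k ν).isLt).le]
        congr 1; ring

/-- **THE WEIGHTED ALIAS TERM**: `‖h_{l;μλ}(p′)‖·wt163 ≤ c_HW·c_wt·Π_ν 12·ω_n(l_ν)^{−(1+(1−α)/d)}`, `l ≠ 0`. [folklore] -/
theorem weighted_term_le {κ : ℝ} (hκ0 : 0 ≤ κ) (hκ : κ ≤ kappa163 d) {p : Fin d → ℂ} (hp : p ∈ Strip d κ)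
    (μ lam ν₀ : Fin d) (k : Fin d → Fin n) (hk : k ≠ fun _ => 0) {α : ℝ} (hα0 : 0 ≤ α) (hα1 : α ≤ 1) :
    ‖h163 n μ lam k p‖ * wt163 n k p ν₀ α ≤
      cHW d * cWt d * ∏ ν, (12 * omega n (k ν) ^ (-(1 + (1 - α) / d))) := by
  have hd : 0 < d := Fin.pos μ
  have hκ1 : κ ≤ 1 := (kappa_small hκ0 (hκ.trans (kappa163_le_rOf d))).1
  have hW1 := one_le_W n k hk
  have hW0 : 0 < W n k := by linarith
  have hC0 : 0 ≤ cHW d * cWt d := mul_nonneg (cHW_nonneg d) (cWt_nonneg d)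
  have hA0 : 0 ≤ ∏ ν, 12 / omega n (k ν) :=
    Finset.prod_nonneg (fun ν _ => div_nonneg (by norm_num) (omega_pos n (k ν) (k ν).isLt).le)
  have hh := norm_h163_le_W n hκ0 hκ hp μ lam k hk
  have hw := wt163_le_of_ne n hκ1 hp k hk ν₀ hα0 hα1
  have step2 : (1 / W n k) * W n k ^ ((1 + α) / 2) = W n k ^ ((α - 1) / 2) := by
    rw [show (α - 1) / 2 = (1 + α) / 2 - 1 by ring, Real.rpow_sub_one hW0.ne']
    ring
  have step3 := W_rpow_le_prod163 n hd k hk hα1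
  have step4 : (∏ ν, 12 / omega n (k ν)) * (∏ ν, omega n (k ν) ^ (-((1 - α) / d))) =
      ∏ ν, (12 * omega n (k ν) ^ (-(1 + (1 - α) / d))) := by
    rw [← Finset.prod_mul_distrib]
    refine Finset.prod_congr rfl (fun ν _ => ?_)
    have hω := omega_pos n (k ν) (k ν).isLt
    rw [div_eq_mul_inv, ← Real.rpow_neg_one, mul_assoc, ← Real.rpow_add hω]
    congr 1; congr 1; ring
  calc ‖h163 n μ lam k p‖ * wt163 n k p ν₀ α
      ≤ (cHW d * ((∏ ν, 12 / omega n (k ν)) * (1 / W n k))) * (cWt d * W n k ^ ((1 + α) / 2)) :=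
        mul_le_mul hh hw (wt163_nonneg n k p ν₀ α) (mul_nonneg (cHW_nonneg d) (mul_nonneg hA0 (by positivity)))
    _ = cHW d * cWt d * ((∏ ν, 12 / omega n (k ν)) * ((1 / W n k) * W n k ^ ((1 + α) / 2))) := by ring
    _ = cHW d * cWt d * ((∏ ν, 12 / omega n (k ν)) * W n k ^ ((α - 1) / 2)) := by rw [step2]
    _ ≤ cHW d * cWt d * ((∏ ν, 12 / omega n (k ν)) * ∏ ν, omega n (k ν) ^ (-((1 - α) / d))) :=
        mul_le_mul_of_nonneg_left (mul_le_mul_of_nonneg_left step3 hA0) hC0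
    _ = cHW d * cWt d * ∏ ν, (12 * omega n (k ν) ^ (-(1 + (1 - α) / d))) := by rw [step4]

omit [NeZero n] in
/-- `Σ_l Π_ν 12·ω_n(l_ν)^{−e} ≤ (24 ζ(e))^d`, uniformly in `n` (`e > 1`). [folklore] -/
theorem sum_prod_rpow_le163 {e : ℝ} (he : 1 < e) :
    ∑ k : Fin d → Fin n, ∏ ν, (12 * omega n (k ν) ^ (-e)) ≤ (24 * zetaS e) ^ d := by
  have h := Finset.prod_univ_sum (fun _ : Fin d => (Finset.univ : Finset (Fin n)))
    (fun _ j => 12 * omega n (j : ℕ) ^ (-e))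
  rw [Fintype.piFinset_univ] at h
  rw [← h]
  have hS : ∑ j : Fin n, 12 * omega n (j : ℕ) ^ (-e) ≤ 24 * zetaS e := by
    rw [← Finset.mul_sum]
    have := sum_omega_rpow_le_zetaS n he
    linarith
  have hS0 : 0 ≤ ∑ j : Fin n, 12 * omega n (j : ℕ) ^ (-e) :=
    Finset.sum_nonneg (fun j _ => mul_nonneg (by norm_num) (Real.rpow_nonneg (omega_pos n j j.isLt).le _))
  calc ∏ _ν : Fin d, ∑ j : Fin n, 12 * omega n (j : ℕ) ^ (-e)
      ≤ ∏ _ν : Fin d, (24 * zetaS e) := Finset.prod_le_prod (fun _ _ => hS0) (fun _ _ => hS)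
    _ = (24 * zetaS e) ^ d := by simp

end Term

/-! ## §5. The printed weighted alias sum -/

section Main

variable (n : ℕ) [NeZero n]

/-- THE CONSTANT `C_H(d, α) = M₁₆₃·c_wt + c_HW·c_wt·(24 ζ(1+(1−α)/d))^d` of the weighted alias sum (depends on `d`
and `α` only; diverges as `α → 1`). [folklore] -/
def CHolder163 (d : ℕ) (α : ℝ) : ℝ :=
  M163 d * cWt d + cHW d * cWt d * (24 * zetaS (1 + (1 - α) / d)) ^ d

/-- **THE PRINTED WEIGHTED ALIAS SUM (B5 p. 28–29), CERTIFIED WITH OUR CONSTANT**: for `d ≥ 1`, every `n ≥ 1`,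
`0 ≤ κ ≤ κ₁₆₃(d)`, `p′ ∈ Strip d κ`, all `μ, λ, ν` and `0 ≤ α < 1`,
`Σ_{l ∈ 2π{0,…,n−1}^d} ‖h_{l;μλ}(p′)‖ · ‖∂_ν(p′+l)‖ · (Σ_ν′‖∂_ν′(p′+l)‖²)^{α/2} ≤ C_H(d, α)`.
[cite: Balaban1984PropagatorsI, p.29 lines 1–2 (text of the claim only; proof and constant ours)] [folklore] -/
theorem weighted_alias_sum_le {κ : ℝ} (hκ0 : 0 ≤ κ) (hκ : κ ≤ kappa163 d) {p : Fin d → ℂ}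
    (hp : p ∈ Strip d κ) (μ lam ν₀ : Fin d) {α : ℝ} (hα0 : 0 ≤ α) (hα1 : α < 1) :
    ∑ k : Fin d → Fin n, ‖h163 n μ lam k p‖ * wt163 n k p ν₀ α ≤ CHolder163 d α := by
  classical
  have hd : 0 < d := Fin.pos μ
  have hκ1 : κ ≤ 1 := (kappa_small hκ0 (hκ.trans (kappa163_le_rOf d))).1
  have he : 1 < 1 + (1 - α) / d := by
    have : (0 : ℝ) < (1 - α) / d := div_pos (by linarith) (by exact_mod_cast hd)
    linarith
  set g : (Fin d → Fin n) → ℝ := fun k => ∏ ν, (12 * omega n (k ν) ^ (-(1 + (1 - α) / d))) with hgdef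
  have hg0 : ∀ k, 0 ≤ g k := fun k =>
    Finset.prod_nonneg (fun ν _ => mul_nonneg (by norm_num) (Real.rpow_nonneg (omega_pos n (k ν) (k ν).isLt).le _))
  have hC0 : 0 ≤ cHW d * cWt d := mul_nonneg (cHW_nonneg d) (cWt_nonneg d)
  have hbd : ∀ k : Fin d → Fin n, ‖h163 n μ lam k p‖ * wt163 n k p ν₀ α ≤
      (if k = (fun _ => 0) then M163 d * cWt d else 0) + cHW d * cWt d * g k := by
    intro k
    by_cases hk : k = fun _ => 0
    · rw [if_pos hk]
      subst hk
      have h1 := norm_h163_le n hκ0 hκ hp μ lam (fun _ => 0)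
      have h2 := wt163_zero_le n hκ1 hp ν₀ hα0 hα1.le
      have h3 : ‖h163 n μ lam (fun _ => 0) p‖ * wt163 n (fun _ => 0) p ν₀ α ≤ M163 d * cWt d :=
        mul_le_mul h1 h2 (wt163_nonneg n _ p ν₀ α) ((norm_nonneg _).trans h1)
      have h4 : 0 ≤ cHW d * cWt d * g (fun _ => 0) := mul_nonneg hC0 (hg0 _)
      linarith
    · rw [if_neg hk, zero_add]
      exact weighted_term_le n hκ0 hκ hp μ lam ν₀ k hk hα0 hα1.le
  calc ∑ k : Fin d → Fin n, ‖h163 n μ lam k p‖ * wt163 n k p ν₀ α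
      ≤ ∑ k : Fin d → Fin n, ((if k = (fun _ => 0) then M163 d * cWt d else 0) + cHW d * cWt d * g k) :=
        Finset.sum_le_sum (fun k _ => hbd k)
    _ = M163 d * cWt d + cHW d * cWt d * ∑ k : Fin d → Fin n, g k := by
        rw [Finset.sum_add_distrib, Finset.sum_ite_eq' Finset.univ (fun _ => (0 : Fin n)),
          if_pos (Finset.mem_univ _), Finset.mul_sum]
    _ ≤ M163 d * cWt d + cHW d * cWt d * (24 * zetaS (1 + (1 - α) / d)) ^ d := by
        have hsum : ∑ k : Fin d → Fin n, g k ≤ (24 * zetaS (1 + (1 - α) / d)) ^ d :=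
          sum_prod_rpow_le163 (d := d) n he
        have := mul_le_mul_of_nonneg_left hsum hC0
        linarith
    _ = CHolder163 d α := rfl

/-- **THE PRINTED SETTING (real momenta)**: for `p′ = s ∈ [−π,π]^d` (where `dC = ∂_ν(p′+l)` is the genuine lattice
symbol, `B5Hk163Strip.dC_ofReal`), every `n ≥ 1`, `μ, λ, ν`, `0 ≤ α < 1`:
`Σ_l ‖h_{l;μλ}(s)‖·|∂_ν(s+l)|·Δ^η(s+l)^{α/2} ≤ C_H(d, α)`. [cite: Balaban1984PropagatorsI, p.29 lines 1–2 (text only)] [folklore] -/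
theorem weighted_alias_sum_le_real {s : Fin d → ℝ} (hs : s ∈ BZ d) (μ lam ν₀ : Fin d) {α : ℝ}
    (hα0 : 0 ≤ α) (hα1 : α < 1) :
    ∑ k : Fin d → Fin n, ‖h163 n μ lam k (ofRealVec s)‖ * wt163 n k (ofRealVec s) ν₀ α ≤ CHolder163 d α :=
  weighted_alias_sum_le n le_rfl (kappa163_pos d).le (ofRealVec_mem_Strip le_rfl hs) μ lam ν₀ hα0 hα1

end Main

end

end Literature.MathematicalPhysics.QuantumFieldTheory.Balaban1983to89.B5Hk163Holder
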